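import Summits.Schanuel.Schanuel.Theorems.RootDecomp1KOnePointCell02

/-!
# RootDecomp1KOnePointCell — lens 1, generation 39 «ONE-POINT ZERO ESTIMATE + LOG-LOG WALL CELL of 33364» ((1, ℓ₂, ℓ₃, ρ) for every log-log-Liouville ρ) — continuation (RootDecomp1KOnePointCell03): §3 (T) the truncation lemmas, `weight_injective`, `final_count`, THE ONE-POINT ZERO ESTIMATE `onePoint_nonvanishing` (`maxHeartbeats 800000` as in the source) and `onePoint_nonvanishing_of_le`

(lens-1 g39 `RootDecomp1KOnePointCell.lean` [HOME/decomp-schanuel-lens-1/g39/RootDecomp1KOnePointCell.lean sha256 4a1f4bc8…4211, 2530 l + OPprobe + OPctrl + NODE-g39.md; NOTE/CLAIM L1801, ACK + CHECKLIST K-g39 L1803, presearch (6) resolved by the critic L1810, NODE L1824 / REQUEST L1825 / RESULT L1826]; port by census-1 gen 16 in ten parts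
`RootDecomp1KOnePointCell01`–`10` — see the PORT NOTE of part 01; `--supports stmt-Schanuel-33364`; rung 0.)
-/

open Complex IntermediateField Polynomial
open Summit.Schanuel.Schanuel.Theorems.RootDecomp1KHyper
open Summit.Schanuel.Schanuel.Theorems.RootDecomp1KHyper.HyperCell
open Summit.Schanuel.Schanuel.Theorems.RootDecomp1KGeneric
open Summit.Schanuel.Schanuel.Theorems.RootDecomp1KRelLiouvilleCell
open Summit.Schanuel.Schanuel.Theorems.RootDecomp1KLogLogCell
open Summit.Schanuel.Schanuel.Theorems.RootDecomp1KTwoBaseCell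
open Summit.Schanuel.Schanuel.Theorems.RootDecomp1KMeasuredWallCell

namespace Summit.Schanuel.Schanuel.Theorems.RootDecomp1KOnePointCell

/-! ## §3  (T) THE ONE-POINT ZERO ESTIMATE at the simultaneous truncations `(s³_K, s²_K)` -/

section OnePoint
open LiouvilleNumber
open scoped Nat

/-- The EXACT increment of consecutive truncations: `s^b_{K+1} = s^b_K + b^{−(K+1)!}`. -/
theorem psQ_succ (b K : ℕ) : psQ b (K + 1) = psQ b K + 1 / (b : ℚ) ^ (K + 1)! := by
  unfold psQ
  rw [Finset.sum_range_succ]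

/-- `psNumer 3 K < 3^{K!}` (`s³_K < 1`). -/
theorem psNumer_three_lt (K : ℕ) : (psNumer 3 K : ℤ) < (3 : ℤ) ^ K ! := by
  have h1 : ((psQ 3 K : ℚ) : ℝ) < 1 := by
    rw [psQ_cast]; push_cast
    exact (partialSum_pos_lt (by norm_num : (1 : ℝ) < 3) K).2.trans liouvilleNumber_three_lt_one
  have h2 : (psQ 3 K : ℚ) < 1 := by exact_mod_cast h1
  rw [psQ_eq_div (by norm_num)] at h2
  have h3 : (0 : ℚ) < ((3 : ℕ) : ℚ) ^ K ! := by positivity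
  rw [div_lt_one h3] at h2
  exact_mod_cast h2

/-- `psNumer 2 K < 2 · 2^{K!}` (`s²_K < 2`). -/
theorem psNumer_two_lt (K : ℕ) : (psNumer 2 K : ℤ) < 2 * (2 : ℤ) ^ K ! := by
  have h1 : ((psQ 2 K : ℚ) : ℝ) < 2 := by
    rw [psQ_cast]; push_cast
    have := (partialSum_pos_lt (by norm_num : (1 : ℝ) < 2) K).2
    linarith [liouvilleNumber_two_lt]
  have h2 : (psQ 2 K : ℚ) < 2 := by exact_mod_cast h1
  rw [psQ_eq_div (by norm_num)] at h2
  have h3 : (0 : ℚ) < ((2 : ℕ) : ℚ) ^ K ! := by positivity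
  rw [div_lt_iff₀ h3] at h2
  exact_mod_cast h2

/-- **Unique factorisation of the weights:** `3^{d−a} 2^{d−b}` determines `(a, b)` (`a, b ≤ d`).  This is the
ONLY base-specific input of the one-point estimate (multiplicative independence of the two bases). -/
theorem weight_injective {d a b a' b' : ℕ} (ha : a ≤ d) (hb : b ≤ d) (ha' : a' ≤ d) (hb' : b' ≤ d)
    (h : 3 ^ (d - a) * 2 ^ (d - b) = 3 ^ (d - a') * 2 ^ (d - b')) : a = a' ∧ b = b' := by
  have hv : ∀ x y : ℕ, padicValNat 2 (3 ^ x * 2 ^ y) = y := by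
    intro x y
    have hodd : ¬ 2 ∣ 3 ^ x := by
      rw [Nat.two_dvd_ne_zero]; exact Nat.odd_iff.mp (Odd.pow (Nat.odd_iff.mpr (by norm_num)))
    rw [padicValNat.mul (pow_ne_zero _ (by norm_num)) (pow_ne_zero _ (by norm_num)),
      padicValNat.eq_zero_of_not_dvd hodd, padicValNat.prime_pow, zero_add]
  have hbb : d - b = d - b' := by
    have h1 := hv (d - a) (d - b)
    rw [h, hv] at h1
    exact h1.symm
  rw [hbb] at h
  have h3 : 3 ^ (d - a) = 3 ^ (d - a') := Nat.eq_of_mul_eq_mul_right (by positivity) h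
  have haa : d - a = d - a' := Nat.pow_right_injective (by norm_num : 2 ≤ 3) h3
  omega

/-- **(T) THE ONE-POINT ZERO ESTIMATE (hypothesis-free).** A non-zero `F ∈ ℤ[x][y]` of partial degrees
`≤ d` and height `≤ L` does NOT vanish at the single point `(x, y) = (s³_K, s²_K)` as soon as
`K ≥ 6^{d+2}(d+1)` and `L^{2·6^d} ≤ 2^{K!}` — ONE scale `K`, with `K! ≍_d log L`, uniformly in `F`.

Mechanism (new): RE-CENTRE at the PREVIOUS truncation `(s³_{K−1}, s²_{K−1}) = (A/3^{N'}, B/2^{N'})`,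
`N' = (K−1)!`, after rescaling `x ↦ 3^{N'}x, y ↦ 2^{N'}y` so that the centre `(A, B)` is an INTEGER point:
the shifted polynomial `G = F̃(X + A, Y + B) ∈ ℤ[X][Y]` is non-zero of the same degrees and of height
`≤ (d+1)² 8^d 36^{dN'} L`, and the EXACT increments `s³_K − s³_{K−1} = 3^{−K!}`, `s²_K − s²_{K−1} = 2^{−K!}`
turn `F(s³_K, s²_K) = 0` into the integer relation `Σ_{a,b ≤ d} G_{ba} (3^{d−a} 2^{d−b})^M = 0`,
`M = (K−1)(K−1)!`; the weights `3^{d−a}2^{d−b} ≤ 6^d` are PAIRWISE DISTINCT (unique factorisation), so the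
term of extreme weight DOMINATES (`dominance`): `2^{M/6^d} ≤ (d+1)^4 8^d 36^{dN'} L`, contradicting
`L² ≤ 2^{K!/6^d}` and `K ≥ 6^{d+2}(d+1)` (`final_count`).  No window, no congruence, no named fact. -/
theorem final_count {K' d m q : ℕ} (hK : 36 * m * (d + 1) ≤ K' + 1) (hm1 : 1 ≤ m) (hq1 : 1 ≤ q)
    (hexp : 2 * (K' * q) ≤ 2 * (7 * d + 6 * d * (m * q)) + (K' + 1) * q) : False := by
  have hKq : 36 * m * (d + 1) * q ≤ (K' + 1) * q := Nat.mul_le_mul_right q hK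
  have hmq : q ≤ m * q := Nat.le_mul_of_pos_left q hm1
  have hdq : d ≤ d * (m * q) := Nat.le_mul_of_pos_right d (Nat.mul_pos hm1 hq1)
  nlinarith

set_option maxHeartbeats 800000 in
/-- **(T) THE ONE-POINT ZERO ESTIMATE** at the simultaneous truncations `(s³_K, s²_K)`: a non-zero `F ∈ ℤ[x][y]` of partial degrees `≤ d` and height `≤ L` does not vanish at `(psQ 3 K, psQ 2 K)` once `K ≥ 36(d+1)²`-ish and `L^{6^{d+1}} < 2^{K!}` (Taylor re-centring at the previous truncation + dominance of the extreme weight; hypothesis-free). -/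
theorem onePoint_nonvanishing (F : ℤ[X][X]) (hF : F ≠ 0) {d K : ℕ} {L : ℤ}
    (hdegy : F.natDegree ≤ d) (hdegx : ∀ i, (F.coeff i).natDegree ≤ d)
    (hcoef : ∀ i j, |(F.coeff i).coeff j| ≤ L)
    (hK : 6 ^ (d + 2) * (d + 1) ≤ K) (hL : L ^ (2 * 6 ^ d) ≤ (2 : ℤ) ^ K !) :
    evxy (psQ 3 K) (psQ 2 K) F ≠ 0 := by
  classical
  intro hzero
  have hL0 : 0 ≤ L := (abs_nonneg _).trans (hcoef 0 0)
  -- the scales: K = K' + 1, N' = K'!, M = K'·K'!, m = 6^d ∣ N' = m q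
  set m : ℕ := 6 ^ d with hmdef
  have hm1 : 1 ≤ m := Nat.one_le_pow _ _ (by norm_num)
  have hm0 : m ≠ 0 := by omega
  have h36 : 6 ^ (d + 2) = 36 * m := by rw [hmdef, pow_add]; ring
  rw [h36] at hK
  have h36m : 36 ≤ 36 * m * (d + 1) := by nlinarith
  obtain ⟨K', rfl⟩ : ∃ K', K = K' + 1 := ⟨K - 1, by omega⟩
  set N' : ℕ := K' ! with hN'def
  have hN'pos : 0 < N' := Nat.factorial_pos K'
  set M : ℕ := K' * N' with hMdef
  have hK'1 : 1 ≤ K' := by omega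
  have hM1 : 1 ≤ M := Nat.mul_pos (by omega) hN'pos
  have hfact : (K' + 1)! = M + N' := by rw [hMdef, hN'def, Nat.factorial_succ]; ring
  have hmK' : m ≤ K' := by
    have : 36 * m ≤ 36 * m * (d + 1) := Nat.le_mul_of_pos_right _ (by omega)
    omega
  obtain ⟨q, hq⟩ : m ∣ N' := Nat.dvd_factorial hm1 hmK'
  have hq1 : 1 ≤ q := by
    rcases Nat.eq_zero_or_pos q with h | h
    · exfalso; rw [h, mul_zero] at hq; omega
    · exact h
  have hmM : m ∣ M := ⟨K' * q, by rw [hMdef, hq]; ring⟩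
  have hMm : M / m = K' * q := by
    rw [hMdef, hq, show K' * (m * q) = m * (K' * q) by ring, Nat.mul_div_cancel_left _ (by omega)]
  -- the integer data: s = 3^{N'}, t = 2^{N'}, centre (A, B) = (psNumer 3 K', psNumer 2 K')
  set s : ℤ := 3 ^ N' with hsdef
  set t : ℤ := 2 ^ N' with htdef
  have hs1 : 1 ≤ s := one_le_pow₀ (by norm_num)
  have ht1 : 1 ≤ t := one_le_pow₀ (by norm_num)
  have hs0 : 0 ≤ s := by linarith
  have ht0 : 0 ≤ t := by linarith
  set A : ℤ := (psNumer 3 K' : ℤ) with hAdef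
  set B : ℤ := (psNumer 2 K' : ℤ) with hBdef
  have hA : |A| ≤ s := by
    rw [abs_of_nonneg (by positivity), hAdef, hsdef]; exact (psNumer_three_lt K').le
  have hB : |B| ≤ 2 * t := by
    rw [abs_of_nonneg (by positivity), hBdef, htdef]; exact (psNumer_two_lt K').le
  have h2t1 : 1 ≤ 2 * t := by linarith
  -- the evaluation point after rescaling: (s·s³_K, t·s²_K) = (A + 3^{−M}, B + 2^{−M})
  set u : ℚ := 1 / (3 : ℚ) ^ M with hudef
  set v : ℚ := 1 / (2 : ℚ) ^ M with hvdef
  have hx : (s : ℚ) * psQ 3 (K' + 1) = u + A := by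
    rw [psQ_succ, psQ_eq_div (by norm_num), hfact, hsdef, hAdef, hudef]
    push_cast
    field_simp
    ring
  have hy : (t : ℚ) * psQ 2 (K' + 1) = v + B := by
    rw [psQ_succ, psQ_eq_div (by norm_num), hfact, htdef, hBdef, hvdef]
    push_cast
    field_simp
    ring
  -- the rescaled-and-shifted polynomial G ∈ ℤ[X][Y]: non-zero, degrees ≤ d, height ≤ Bnd
  set Fs : ℤ[X][X] := scaleXY F s t d with hFsdef
  set G : ℤ[X][X] := shiftXY Fs A B with hGdef
  have hFs0 : Fs ≠ 0 := scaleXY_ne_zero F hF (by positivity) (by positivity) hdegy hdegx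
  have hG0 : G ≠ 0 := shiftXY_ne_zero Fs hFs0 A B
  have hGdegy : G.natDegree ≤ d := natDegree_shiftXY_le Fs A B (natDegree_scaleXY_le F s t d)
  have hGdegx : ∀ b, (G.coeff b).natDegree ≤ d :=
    natDegree_coeff_shiftXY_le Fs A B (natDegree_coeff_scaleXY_le F s t d)
  set Bnd : ℤ := (d + 1) * 2 ^ d * s ^ d * ((d + 1) * 2 ^ d * (2 * t) ^ d * (L * s ^ d * t ^ d))
    with hBnddef
  have hGcoef : ∀ b a, |(G.coeff b).coeff a| ≤ Bnd := fun b a =>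
    abs_coeff_coeff_shiftXY_le Fs (natDegree_scaleXY_le F s t d) (natDegree_coeff_scaleXY_le F s t d)
      (abs_coeff_coeff_scaleXY_le F hs1 ht1 d hcoef) hA hs1 hB h2t1 b a
  -- G(3^{−M}, 2^{−M}) = s^d t^d F(s³_K, s²_K) = 0
  have hGuv : evxy u v G = 0 := by
    rw [hGdef, evxy_shiftXY, ← hx, ← hy, hFsdef, evxy_scaleXY F s t hdegy hdegx, hzero, mul_zero]
  rw [evxy_eq_sum_sum u v G hGdegy hGdegx] at hGuv
  -- cleared of denominators: Σ_{b,a ≤ d} G_{ba} (3^{d−a} 2^{d−b})^M = 0 over ℤ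
  have hZsum : ∑ b ∈ Finset.range (d + 1), ∑ a ∈ Finset.range (d + 1),
      (G.coeff b).coeff a * (((3 ^ (d - a) * 2 ^ (d - b) : ℕ) : ℤ)) ^ M = 0 := by
    have h3 : (3 : ℚ) ^ M ≠ 0 := by positivity
    have h2 : (2 : ℚ) ^ M ≠ 0 := by positivity
    have key : ∀ b ∈ Finset.range (d + 1), ∀ a ∈ Finset.range (d + 1),
        (((G.coeff b).coeff a : ℤ) : ℚ) * u ^ a * v ^ b * ((3 : ℚ) ^ (d * M) * (2 : ℚ) ^ (d * M)) =
          (((G.coeff b).coeff a * (((3 ^ (d - a) * 2 ^ (d - b) : ℕ) : ℤ)) ^ M : ℤ) : ℚ) := by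
      intro b hb a ha
      have ha' : a ≤ d := by have := Finset.mem_range.mp ha; omega
      have hb' : b ≤ d := by have := Finset.mem_range.mp hb; omega
      have hsplit3 : d * M = (d - a) * M + M * a := by
        rw [mul_comm M a, ← Nat.add_mul, Nat.sub_add_cancel ha']
      have hsplit2 : d * M = (d - b) * M + M * b := by
        rw [mul_comm M b, ← Nat.add_mul, Nat.sub_add_cancel hb']
      have e3 : (3 : ℚ) ^ (d * M) * u ^ a = (3 : ℚ) ^ ((d - a) * M) := by
        rw [hudef, hsplit3, pow_add, pow_mul (3 : ℚ) M a, mul_assoc, ← mul_pow, mul_one_div_cancel h3,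
          one_pow, mul_one]
      have e2 : (2 : ℚ) ^ (d * M) * v ^ b = (2 : ℚ) ^ ((d - b) * M) := by
        rw [hvdef, hsplit2, pow_add, pow_mul (2 : ℚ) M b, mul_assoc, ← mul_pow, mul_one_div_cancel h2,
          one_pow, mul_one]
      rw [show (((G.coeff b).coeff a * (((3 ^ (d - a) * 2 ^ (d - b) : ℕ) : ℤ)) ^ M : ℤ) : ℚ) =
          (((G.coeff b).coeff a : ℤ) : ℚ) * ((3 : ℚ) ^ ((d - a) * M) * (2 : ℚ) ^ ((d - b) * M)) by
        push_cast; rw [mul_pow, ← pow_mul, ← pow_mul], ← e3, ← e2]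
      ring
    have hsumQ : (∑ b ∈ Finset.range (d + 1), ∑ a ∈ Finset.range (d + 1),
        (((G.coeff b).coeff a : ℤ) : ℚ) * u ^ a * v ^ b) * ((3 : ℚ) ^ (d * M) * (2 : ℚ) ^ (d * M)) = 0 := by
      rw [hGuv, zero_mul]
    rw [Finset.sum_mul] at hsumQ
    simp_rw [Finset.sum_mul] at hsumQ
    rw [Finset.sum_congr rfl (fun b hb => Finset.sum_congr rfl (fun a ha => key b hb a ha))] at hsumQ
    exact_mod_cast hsumQ
  -- the box as a product finset; DOMINANCE
  set S : Finset (ℕ × ℕ) := Finset.range (d + 1) ×ˢ Finset.range (d + 1) with hSdef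
  have hZsum' : ∑ p ∈ S, (G.coeff p.1).coeff p.2 * (((3 ^ (d - p.2) * 2 ^ (d - p.1) : ℕ) : ℤ)) ^ M = 0 := by
    rw [hSdef, Finset.sum_product]; exact hZsum
  have he1 : ∀ p ∈ S, 1 ≤ 3 ^ (d - p.2) * 2 ^ (d - p.1) := fun p _ =>
    Nat.one_le_iff_ne_zero.mpr (by positivity)
  have hem : ∀ p ∈ S, 3 ^ (d - p.2) * 2 ^ (d - p.1) ≤ m := by
    intro p _
    have h6 : m = 3 ^ d * 2 ^ d := by rw [hmdef, ← mul_pow]; norm_num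
    rw [h6]
    exact Nat.mul_le_mul (Nat.pow_le_pow_right (by norm_num) (Nat.sub_le _ _))
      (Nat.pow_le_pow_right (by norm_num) (Nat.sub_le _ _))
  have hinj : ∀ p ∈ S, ∀ p' ∈ S,
      3 ^ (d - p.2) * 2 ^ (d - p.1) = 3 ^ (d - p'.2) * 2 ^ (d - p'.1) → p = p' := by
    intro p hp p' hp' h
    obtain ⟨hb, ha⟩ := Finset.mem_product.mp hp
    obtain ⟨hb', ha'⟩ := Finset.mem_product.mp hp'
    rw [Finset.mem_range] at ha hb ha' hb'
    obtain ⟨h1, h2⟩ := weight_injective (d := d) (by omega) (by omega) (by omega) (by omega) h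
    exact Prod.ext h2 h1
  have hZ : ∀ p ∈ S, |(G.coeff p.1).coeff p.2| ≤ Bnd := fun p _ => hGcoef p.1 p.2
  have hne : ∃ p ∈ S, (G.coeff p.1).coeff p.2 ≠ 0 := by
    have hGb : G.coeff G.natDegree ≠ 0 := by
      have := Polynomial.leadingCoeff_ne_zero.mpr hG0
      rwa [Polynomial.leadingCoeff] at this
    have hGba : (G.coeff G.natDegree).coeff (G.coeff G.natDegree).natDegree ≠ 0 := by
      have := Polynomial.leadingCoeff_ne_zero.mpr hGb
      rwa [Polynomial.leadingCoeff] at this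
    refine ⟨(G.natDegree, (G.coeff G.natDegree).natDegree), ?_, hGba⟩
    rw [hSdef, Finset.mem_product, Finset.mem_range, Finset.mem_range]
    exact ⟨Nat.lt_succ_of_le hGdegy, Nat.lt_succ_of_le (hGdegx _)⟩
  have hdom := dominance S (fun p => (G.coeff p.1).coeff p.2)
    (fun p => 3 ^ (d - p.2) * 2 ^ (d - p.1)) (m := m) (M := M) (B := Bnd)
    hM1 he1 hem hinj hZ hne hZsum'
  have hdom2 : (2 : ℤ) ^ (K' * q) ≤ (S.card : ℤ) * Bnd := by
    rw [← hMm]; exact two_pow_le_of_dominance hm1 hmM hdom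
  have hcard : S.card = (d + 1) * (d + 1) := by
    rw [hSdef, Finset.card_product, Finset.card_range]
  rw [hcard] at hdom2
  push_cast at hdom2
  -- the final count: 2^{K' q} ≤ (d+1)^4 8^d (st)^{2d} · L =: W · L, W ≤ 2^{7d + 6dN'}, L² ≤ 2^{(K'+1) q}
  set W : ℤ := ((d : ℤ) + 1) ^ 4 * (2 ^ d) ^ 3 * (s * t) ^ (2 * d) with hWdef
  have hWB : ((d : ℤ) + 1) * ((d : ℤ) + 1) * Bnd = W * L := by rw [hBnddef, hWdef]; ring
  have hst0 : 0 ≤ s * t := mul_nonneg hs0 ht0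
  have h2d0 : (0 : ℤ) ≤ (2 ^ d) ^ 3 := by positivity
  have hW0 : 0 ≤ W :=
    mul_nonneg (mul_nonneg (pow_nonneg (by positivity) 4) h2d0) (pow_nonneg hst0 _)
  have hd1 : (d : ℤ) + 1 ≤ 2 ^ d := by exact_mod_cast Nat.lt_two_pow_self
  have hst : s * t ≤ 2 ^ (3 * N') := by
    rw [hsdef, htdef, ← mul_pow, pow_mul]
    exact pow_le_pow_left₀ (by norm_num) (by norm_num) N'
  have hWle : W ≤ 2 ^ (7 * d + 6 * d * N') := by
    have h1 : ((d : ℤ) + 1) ^ 4 ≤ (2 ^ d) ^ 4 := pow_le_pow_left₀ (by positivity) hd1 4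
    have h2 : (s * t) ^ (2 * d) ≤ (2 ^ (3 * N')) ^ (2 * d) := pow_le_pow_left₀ hst0 hst _
    calc W = ((d : ℤ) + 1) ^ 4 * (2 ^ d) ^ 3 * (s * t) ^ (2 * d) := hWdef
      _ ≤ (2 ^ d) ^ 4 * (2 ^ d) ^ 3 * (2 ^ (3 * N')) ^ (2 * d) :=
          mul_le_mul (mul_le_mul_of_nonneg_right h1 h2d0) h2 (pow_nonneg hst0 _) (by positivity)
      _ = 2 ^ (7 * d + 6 * d * N') := by
          rw [← pow_mul, ← pow_mul, ← pow_mul, ← pow_add, ← pow_add]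
          congr 1
          ring
  have hLsq : L ^ 2 ≤ (2 : ℤ) ^ ((K' + 1) * q) := by
    have h1 : (L ^ 2) ^ m ≤ ((2 : ℤ) ^ ((K' + 1) * q)) ^ m := by
      rw [← pow_mul, ← pow_mul, show (K' + 1) * q * m = (K' + 1)! by
        rw [Nat.factorial_succ, ← hN'def, hq]; ring]
      exact hL
    exact (pow_le_pow_iff_left₀ (by positivity) (by positivity) hm0).mp h1
  have hsq : (2 : ℤ) ^ (2 * (K' * q)) ≤ 2 ^ (2 * (7 * d + 6 * d * N')) * 2 ^ ((K' + 1) * q) := by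
    calc (2 : ℤ) ^ (2 * (K' * q)) = (2 ^ (K' * q)) ^ 2 := by rw [pow_mul']
      _ ≤ (W * L) ^ 2 := pow_le_pow_left₀ (by positivity) (hdom2.trans (le_of_eq hWB)) 2
      _ = W ^ 2 * L ^ 2 := by ring
      _ ≤ W ^ 2 * 2 ^ ((K' + 1) * q) := mul_le_mul_of_nonneg_left hLsq (by positivity)
      _ ≤ (2 ^ (7 * d + 6 * d * N')) ^ 2 * 2 ^ ((K' + 1) * q) :=
          mul_le_mul_of_nonneg_right (pow_le_pow_left₀ hW0 hWle 2) (by positivity)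
      _ = 2 ^ (2 * (7 * d + 6 * d * N')) * 2 ^ ((K' + 1) * q) := by
          rw [← pow_mul' (2 : ℤ) 2 (7 * d + 6 * d * N')]
  rw [← pow_add] at hsq
  have hexp : 2 * (K' * q) ≤ 2 * (7 * d + 6 * d * N') + (K' + 1) * q :=
    (pow_le_pow_iff_right₀ (by norm_num : (1 : ℤ) < 2)).mp hsq
  -- contradiction with K' + 1 ≥ 36 m (d+1), N' = m q
  rw [hq] at hexp
  exact final_count hK hm1 hq1 hexp

/-- **(T′) eventually in `K`:** once the two hypotheses hold at `K`, they hold at every `K' ≥ K`, so the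
non-vanishing is permanent from the first admissible scale on. -/
theorem onePoint_nonvanishing_of_le (F : ℤ[X][X]) (hF : F ≠ 0) {d K K₁ : ℕ} {L : ℤ}
    (hdegy : F.natDegree ≤ d) (hdegx : ∀ i, (F.coeff i).natDegree ≤ d)
    (hcoef : ∀ i j, |(F.coeff i).coeff j| ≤ L)
    (hK : 6 ^ (d + 2) * (d + 1) ≤ K) (hL : L ^ (2 * 6 ^ d) ≤ (2 : ℤ) ^ K !) (hKK₁ : K ≤ K₁) :
    evxy (psQ 3 K₁) (psQ 2 K₁) F ≠ 0 :=
  onePoint_nonvanishing F hF hdegy hdegx hcoef (hK.trans hKK₁)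
    (hL.trans (pow_le_pow_right₀ (by norm_num) (Nat.factorial_le hKK₁)))

end OnePoint

end Summit.Schanuel.Schanuel.Theorems.RootDecomp1KOnePointCell
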